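import Mathlib
import HarnessLib
import Literature.MathematicalPhysics.QuantumLattice.GrassmannGramFormAlgebra

/-!
# Route `KLProgramme` — crux K3, the nested two-volume pass (β′ «semigroup defect»): GRAM DATA of the block defect pieces `C^cop`, `D_far`, `D_near`
# (cell gate-hubbard-kl, seat hubbard-kl-k3c4-p1 g7; companion of `…TwoVolumeBlockDefect` §1–§3 and of `…TwoVolumeDefectStep`)

Block structure `e : Γ′ ≃ ι × Γ`; copies covariance `C^cop X′ Y′ = [blk X′ = blk Y′]·C (π X′) (π Y′)`, defect `D := C′ − C^cop`, zone `Zs`,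
`D_far := 1_{Zs×Zs}·D`, `D_near := D − D_far` (given through their entries `hCcop`/`hDf`/`hDn`).  Proved here (model-free):

* `contr_mask` (a SYMMETRIC mask passes through the two-point function `contr`), `contr_copies`, `contr_far`, `contr_near`;
  `far_near_apply_of_charge_eq` (charge selection passes to the pieces);
* `norm_toLp_single`, `inner_toLp_single` (one-block vectors `e_β ⊗ a` in `ℓ²(ι; E)`);
* **`contr_sub_copies_eq_inner`** — a charged Gram form of `D` in `E′ ⊕ ℓ²(ι; E)` from charged Gram forms of `C′` (in `E′`, constant `κ′`) and of
  `C` (in `E`, constant `κ`, lifted blockwise), with `norm_gramD_fst_le/snd_le` (`≤ √(κ′² + κ²)`);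
* **`contr_far_eq_inner_of_form`** — the zone-restricted vectors are the charged Gram FORM of `D_far` (the `(q, f, g, κf)` datum of the far step),
  `norm_ite_mem_le`;
* **`isGramBoundedR_near_of_form`** — `D_near` is replica-Gram-bounded with constant `√(κ_D² + κ_D²)` (mask `1 − 1_Z⊗1_Z = 1_{Zᶜ}⊗1 + 1_Z⊗1_{Zᶜ}`
  realised in `E_D ⊕ E_D`; the `κn` datum of the near step).

Sorry-free; no definition.  References: BETA-PRIME-ROADMAP.md (k3c5-p2 g5) §1 (m3); BGM 2006 (2.80); Pedra–Salmhofer 2008 Thm 1.3;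
`GrassmannGramFormAlgebra` (`contr_gram_sub`, `isGramBoundedR_of_gram`).
-/

noncomputable section

namespace Summit.HubbardSuperconductivity.HubbardSuperconductivity.Theorems.TwoVolumeDefect

set_option linter.dupNamespace false -- summit = problem name (single-conjunct summit), D-0017

open Finset Literature.MathematicalPhysics.QuantumLattice
open scoped InnerProductSpace

universe u

variable {𝕜 : Type*} [RCLike 𝕜] {Γ ι : Type*} {Γ' : Type u} (e : Γ' ≃ ι × Γ)

/-! ## §4 Gram data of the three pieces -/

section Gram

variable {E E' ED : Type*} [NormedAddCommGroup E] [InnerProductSpace 𝕜 E] [NormedAddCommGroup E'] [InnerProductSpace 𝕜 E']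
  [NormedAddCommGroup ED] [InnerProductSpace 𝕜 ED]

/-- A SYMMETRIC mask passes through the two-point function `contr`. [folklore] -/
theorem contr_mask (M N : Matrix Γ' Γ' 𝕜) (m : Γ' → Γ' → Prop) [∀ X Y, Decidable (m X Y)] (hm : ∀ X Y, m X Y → m Y X)
    (hN : ∀ X' Y', N X' Y' = if m X' Y' then M X' Y' else 0) (X' Y' : Γ') :
    contr 𝕜 N X' Y' = if m X' Y' then contr 𝕜 M X' Y' else 0 := by
  rw [contr_apply, contr_apply, hN, hN]
  by_cases h : m X' Y'
  · rw [if_pos h, if_pos (hm _ _ h), if_pos h]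
  · rw [if_neg h, if_neg (fun h' => h (hm _ _ h')), if_neg h, sub_zero, mul_zero]

/-- `contr C^cop X′ Y′ = [blk X′ = blk Y′]·contr C (π X′) (π Y′)`. [folklore] -/
theorem contr_copies [DecidableEq ι] (C : Matrix Γ Γ 𝕜) (Ccop : Matrix Γ' Γ' 𝕜)
    (hCcop : ∀ X' Y', Ccop X' Y' = if (e X').1 = (e Y').1 then C (e X').2 (e Y').2 else 0) (X' Y' : Γ') :
    contr 𝕜 Ccop X' Y' = if (e X').1 = (e Y').1 then contr 𝕜 C (e X').2 (e Y').2 else 0 := by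
  rw [contr_apply, contr_apply, hCcop, hCcop]
  by_cases h : (e X').1 = (e Y').1
  · rw [if_pos h, if_pos h.symm, if_pos h]
  · rw [if_neg h, if_neg (fun h' => h h'.symm), if_neg h, sub_zero, mul_zero]

/-- `contr D_far = 1_{Zs×Zs}·contr (C′ − C^cop)`. [folklore] -/
theorem contr_far (C' Ccop Df : Matrix Γ' Γ' 𝕜) (Zs : Set Γ') [DecidablePred (· ∈ Zs)]
    (hDf : ∀ X' Y', Df X' Y' = if X' ∈ Zs ∧ Y' ∈ Zs then C' X' Y' - Ccop X' Y' else 0) (X' Y' : Γ') :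
    contr 𝕜 Df X' Y' = if X' ∈ Zs ∧ Y' ∈ Zs then contr 𝕜 (C' - Ccop) X' Y' else 0 :=
  contr_mask (C' - Ccop) Df (fun X' Y' => X' ∈ Zs ∧ Y' ∈ Zs) (fun _ _ h => h.symm)
    (fun X' Y' => by rw [hDf, Matrix.sub_apply]) X' Y'

/-- `contr D_near = (1 − 1_{Zs×Zs})·contr (C′ − C^cop)`. [folklore] -/
theorem contr_near (C' Ccop Dn : Matrix Γ' Γ' 𝕜) (Zs : Set Γ') [DecidablePred (· ∈ Zs)]
    (hDn : ∀ X' Y', Dn X' Y' = if X' ∈ Zs ∧ Y' ∈ Zs then 0 else C' X' Y' - Ccop X' Y') (X' Y' : Γ') :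
    contr 𝕜 Dn X' Y' = if ¬ (X' ∈ Zs ∧ Y' ∈ Zs) then contr 𝕜 (C' - Ccop) X' Y' else 0 :=
  contr_mask (C' - Ccop) Dn (fun X' Y' => ¬ (X' ∈ Zs ∧ Y' ∈ Zs)) (fun _ _ h h' => h h'.symm)
    (fun X' Y' => by rw [hDn, Matrix.sub_apply]; split_ifs <;> rfl) X' Y'

/-- Charges: if `C` and `C′` vanish on equal charges, so do `D_far` and `D_near`. [folklore] -/
theorem far_near_apply_of_charge_eq [DecidableEq ι] (q : Γ → Bool) (C : Matrix Γ Γ 𝕜) (C' Ccop Dn Df : Matrix Γ' Γ' 𝕜)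
    (Zs : Set Γ') [DecidablePred (· ∈ Zs)]
    (hCcop : ∀ X' Y', Ccop X' Y' = if (e X').1 = (e Y').1 then C (e X').2 (e Y').2 else 0)
    (hDf : ∀ X' Y', Df X' Y' = if X' ∈ Zs ∧ Y' ∈ Zs then C' X' Y' - Ccop X' Y' else 0)
    (hDn : ∀ X' Y', Dn X' Y' = if X' ∈ Zs ∧ Y' ∈ Zs then 0 else C' X' Y' - Ccop X' Y')
    (hCq : ∀ X Y, q X = q Y → C X Y = 0) (hC'q : ∀ X' Y', q (e X').2 = q (e Y').2 → C' X' Y' = 0) (X' Y' : Γ')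
    (hq : q (e X').2 = q (e Y').2) : Df X' Y' = 0 ∧ Dn X' Y' = 0 := by
  have h0 : C' X' Y' - Ccop X' Y' = 0 := by
    rw [hC'q X' Y' hq, hCcop]
    split_ifs
    · rw [hCq _ _ hq, sub_zero]
    · rw [sub_zero]
  refine ⟨?_, ?_⟩
  · rw [hDf]; split_ifs
    · exact h0
    · rfl
  · rw [hDn]; split_ifs
    · rfl
    · exact h0

/-- The norm of a one-block vector `e_β ⊗ a` in `ℓ²(ι; E)` is `‖a‖`. [folklore] -/
theorem norm_toLp_single [Fintype ι] [DecidableEq ι] (β : ι) (a : E) :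
    ‖(WithLp.toLp 2 (Pi.single β a) : PiLp 2 (fun _ : ι => E))‖ = ‖a‖ := by
  rw [PiLp.norm_eq_of_L2, Finset.sum_eq_single β]
  · simp
  · intro i _ hi; simp [Pi.single_eq_of_ne hi]
  · intro h; exact absurd (Finset.mem_univ _) h

/-- Inner products of one-block vectors: `⟪e_β ⊗ a, e_β′ ⊗ b⟫ = [β = β′]·⟪a, b⟫`. [folklore] -/
theorem inner_toLp_single [Fintype ι] [DecidableEq ι] (β β' : ι) (a b : E) :
    ⟪(WithLp.toLp 2 (Pi.single β a) : PiLp 2 (fun _ : ι => E)), WithLp.toLp 2 (Pi.single β' b)⟫_𝕜 =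
      if β = β' then ⟪a, b⟫_𝕜 else 0 := by
  rw [PiLp.inner_apply, Finset.sum_eq_single β]
  · by_cases h : β = β'
    · subst h; simp
    · simp [h]
  · intro i _ hi; simp [Pi.single_eq_of_ne hi]
  · intro h; exact absurd (Finset.mem_univ _) h

/-- **A charged Gram form of the defect `D = C′ − C^cop`** in `E′ ⊕ ℓ²(ι; E)`, from charged Gram forms of `C′` (in `E′`) and of `C` (in `E`,
lifted blockwise as `e_{blk} ⊗ f(π ·)`), second factor of the copies part negated. [folklore] -/
theorem contr_sub_copies_eq_inner [Fintype ι] [DecidableEq ι] (q : Γ → Bool) (C : Matrix Γ Γ 𝕜) (C' Ccop : Matrix Γ' Γ' 𝕜)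
    (hCcop : ∀ X' Y', Ccop X' Y' = if (e X').1 = (e Y').1 then C (e X').2 (e Y').2 else 0)
    (f g : Γ → E) (f' g' : Γ' → E')
    (hG : ∀ X Y, q X = true → q Y = false → contr 𝕜 C X Y = ⟪f X, g Y⟫_𝕜)
    (hG' : ∀ X' Y', q (e X').2 = true → q (e Y').2 = false → contr 𝕜 C' X' Y' = ⟪f' X', g' Y'⟫_𝕜)
    (X' Y' : Γ') (hX : q (e X').2 = true) (hY : q (e Y').2 = false) :
    contr 𝕜 (C' - Ccop) X' Y' =
      ⟪(WithLp.toLp 2 (f' X', (WithLp.toLp 2 (Pi.single (e X').1 (f (e X').2)) : PiLp 2 (fun _ : ι => E))) :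
          WithLp 2 (E' × PiLp 2 (fun _ : ι => E))),
        WithLp.toLp 2 (g' Y', -(WithLp.toLp 2 (Pi.single (e Y').1 (g (e Y').2)) : PiLp 2 (fun _ : ι => E)))⟫_𝕜 := by
  refine contr_gram_sub (fun X' => q (e X').2) C' Ccop f' g'
    (fun X' => (WithLp.toLp 2 (Pi.single (e X').1 (f (e X').2)) : PiLp 2 (fun _ : ι => E)))
    (fun Y' => (WithLp.toLp 2 (Pi.single (e Y').1 (g (e Y').2)) : PiLp 2 (fun _ : ι => E))) hG' ?_ X' Y' hX hY
  intro X' Y' hX hY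
  rw [contr_copies e C Ccop hCcop, inner_toLp_single]
  split_ifs with h
  · exact hG _ _ hX hY
  · rfl

/-- Norm of the first (row) vector of the defect form: `≤ √(κ′² + κ²)`. [folklore] -/
theorem norm_gramD_fst_le [Fintype ι] [DecidableEq ι] (f : Γ → E) (f' : Γ' → E') {κ κ' : ℝ} (X' : Γ')
    (hf' : ‖f' X'‖ ≤ κ') (hf : ‖f (e X').2‖ ≤ κ) :
    ‖(WithLp.toLp 2 (f' X', (WithLp.toLp 2 (Pi.single (e X').1 (f (e X').2)) : PiLp 2 (fun _ : ι => E))) :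
        WithLp 2 (E' × PiLp 2 (fun _ : ι => E)))‖ ≤ Real.sqrt (κ' ^ 2 + κ ^ 2) :=
  norm_toLp_prod_le hf' (by rw [norm_toLp_single]; exact hf)

/-- Norm of the second (column) vector of the defect form: `≤ √(κ′² + κ²)`. [folklore] -/
theorem norm_gramD_snd_le [Fintype ι] [DecidableEq ι] (g : Γ → E) (g' : Γ' → E') {κ κ' : ℝ} (Y' : Γ')
    (hg' : ‖g' Y'‖ ≤ κ') (hg : ‖g (e Y').2‖ ≤ κ) :
    ‖(WithLp.toLp 2 (g' Y', -(WithLp.toLp 2 (Pi.single (e Y').1 (g (e Y').2)) : PiLp 2 (fun _ : ι => E))) :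
        WithLp 2 (E' × PiLp 2 (fun _ : ι => E)))‖ ≤ Real.sqrt (κ' ^ 2 + κ ^ 2) :=
  norm_toLp_prod_le hg' (by rw [norm_neg, norm_toLp_single]; exact hg)

/-- **The charged Gram FORM of `D_far`**: restrict any Gram form `(F_D, G_D)` of `D = C′ − C^cop` to the zone (vectors set to `0` outside `Zs`).
This is the `(q, f, g, κf)` datum of the far step. [folklore] -/
theorem contr_far_eq_inner_of_form (C' Ccop Df : Matrix Γ' Γ' 𝕜) (Zs : Set Γ') [DecidablePred (· ∈ Zs)]
    (hDf : ∀ X' Y', Df X' Y' = if X' ∈ Zs ∧ Y' ∈ Zs then C' X' Y' - Ccop X' Y' else 0)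
    (FD GD : Γ' → ED) {X' Y' : Γ'} (hFG : contr 𝕜 (C' - Ccop) X' Y' = ⟪FD X', GD Y'⟫_𝕜) :
    contr 𝕜 Df X' Y' = ⟪(if X' ∈ Zs then FD X' else 0), (if Y' ∈ Zs then GD Y' else 0)⟫_𝕜 := by
  rw [contr_far C' Ccop Df Zs hDf]
  by_cases hX : X' ∈ Zs <;> by_cases hY : Y' ∈ Zs <;> simp [hX, hY, hFG]

/-- Norm of a zone-restricted vector. [folklore] -/
theorem norm_ite_mem_le (Zs : Set Γ') [DecidablePred (· ∈ Zs)] (FD : Γ' → ED) {κD : ℝ} (X' : Γ') (hκD : 0 ≤ κD)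
    (h : ‖FD X'‖ ≤ κD) : ‖(if X' ∈ Zs then FD X' else 0)‖ ≤ κD := by
  split_ifs
  · exact h
  · rw [norm_zero]; exact hκD

/-- **`D_near` IS REPLICA-GRAM-BOUNDED** with constant `√(κ_D² + κ_D²) = √2·κ_D` from any charged Gram form of `D` with constant `κ_D`:
the mask `1 − 1_Z ⊗ 1_Z = 1_{Zᶜ} ⊗ 1 + 1_Z ⊗ 1_{Zᶜ}` is realised in `E_D ⊕ E_D`.  This is the `κn` datum of the near step. [folklore] -/
theorem isGramBoundedR_near_of_form [Fintype Γ'] [DecidableEq Γ'] (q : Γ → Bool) (C' Ccop Dn : Matrix Γ' Γ' 𝕜)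
    (Zs : Set Γ') [DecidablePred (· ∈ Zs)]
    (hDn : ∀ X' Y', Dn X' Y' = if X' ∈ Zs ∧ Y' ∈ Zs then 0 else C' X' Y' - Ccop X' Y')
    (hDnq : ∀ X' Y', q (e X').2 = q (e Y').2 → Dn X' Y' = 0)
    (FD GD : Γ' → ED) {κD : ℝ} (hκD : 0 ≤ κD)
    (hFD : ∀ X', q (e X').2 = true → ‖FD X'‖ ≤ κD) (hGD : ∀ Y', q (e Y').2 = false → ‖GD Y'‖ ≤ κD)
    (hFG : ∀ X' Y', q (e X').2 = true → q (e Y').2 = false → contr 𝕜 (C' - Ccop) X' Y' = ⟪FD X', GD Y'⟫_𝕜) :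
    IsGramBoundedR Dn (Real.sqrt (κD ^ 2 + κD ^ 2)) := by
  refine isGramBoundedR_of_gram (fun X' => q (e X').2) Dn hDnq
    (fun X' => (WithLp.toLp 2 ((if X' ∈ Zs then (0 : ED) else FD X'), (if X' ∈ Zs then FD X' else 0)) : WithLp 2 (ED × ED)))
    (fun Y' => (WithLp.toLp 2 (GD Y', (if Y' ∈ Zs then (0 : ED) else GD Y')) : WithLp 2 (ED × ED)))
    (Real.sqrt_nonneg _) (fun X' hX => norm_toLp_prod_le ?_ ?_) (fun Y' hY => norm_toLp_prod_le (hGD Y' hY) ?_) ?_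
  · split_ifs
    · rw [norm_zero]; exact hκD
    · exact hFD X' hX
  · split_ifs
    · exact hFD X' hX
    · rw [norm_zero]; exact hκD
  · split_ifs
    · rw [norm_zero]; exact hκD
    · exact hGD Y' hY
  · intro X' Y' hX hY
    rw [contr_near C' Ccop Dn Zs hDn, WithLp.prod_inner_apply]
    by_cases hXz : X' ∈ Zs <;> by_cases hYz : Y' ∈ Zs <;> simp [hXz, hYz, hFG X' Y' hX hY]

end Gram

end Summit.HubbardSuperconductivity.HubbardSuperconductivity.Theorems.TwoVolumeDefect

end
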